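import Summits.AtomisticToContinuum.HydrodynamicLimit.Theses.ResponseRigidity
import Summits.AtomisticToContinuum.HydrodynamicLimit.Theorems.RelayRaceLocalityNearConstantShortTimeHLMeansNecessary
import Summits.AtomisticToContinuum.HydrodynamicLimit.Theorems.RelayRaceLocalityNearConstantShortTimeHLKineticMoments
import Summits.AtomisticToContinuum.HydrodynamicLimit.Theorems.VitaliAmplitudeTransferAmplitudeTransferIdentification
import Literature.MathematicalPhysics.KineticTheory.HardSphereEulerProofs
import HarnessLib

/-!
# Crux `RestartPrinciple` (stmt-AtomisticToContinuum-12503), line `IdeatorFourSketch` — the (re-typed) conjunct implies the MEAN hydrodynamic limit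

Support file (`--supports stmt-AtomisticToContinuum-12503`, registered sub-goal `meanHydroLimitInBand_of_hydrodynamicLimit`,
the leverage certificate of line `IdeatorFourSketch`; lead c10). RE-LANDING of p128777
(`Theorems/RelayRaceLocalityRestartPrincipleMeanOfGuardedConjunct.lean`, lead a2), whose final theorem was phrased through the
route decl `GermanoSplitLES.HydroLimitInBand` (stmt-AtomisticToContinuum-9133) that route-repair GermanoSplitLES rev 5 dropped, so
that file no longer elaborates; here the consequent `G` of the crux is taken in its registry form, the packing-guarded
sub-problem decl `_root_.HydrodynamicLimit` (statement re-type p126922 — verbatim the same body), and the helper is re-proved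
verbatim under this file's namespace (`…Theorems.RestartPrinciple`, not `….AgeDuhamelForgetting`, to keep the names distinct
from the broken file's). CONTENT: the hydrodynamic limit IN PROBABILITY implies the line's remaining input, the hydrodynamic
limit IN MEAN for smooth test functions, shared item stmt-AtomisticToContinuum-11927 `ResponseRigidity.MeanHydroLimitInBand`.
Together with `restartPrinciple_of_meanProgramme` (`…RestartPrincipleOfConjunct.lean`) and `MeanClosure` (stmt-11929, proved
under this crux, p128739) this closes `RestartPrinciple ⟺ HydrodynamicLimit ⟺ MeanHydroLimitInBand` modulo landed glue.

PROOF (uniform integrability, no dynamics beyond energy conservation). Take `η := η₀` and, profile by profile,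
`σ₀ := min σ₀ (1/2)` (so that the local Gibbs laws are probability measures, `isProbabilityMeasure_localGibbsLaw`). Inside
the frame `G` gives convergence in probability at time `t` of the three empirical fields of `(Φ N).flow t z` under
`P_N = localGibbsLaw σ a₀ u₀ θ₀ N (Φ N)`, for every CONTINUOUS `χ` (a smooth `χ` is continuous). Upgrade to convergence of
the expectations:
* DENSITY: `|ρ_N[χ]| ≤ sup|χ|`, bounded convergence (`HardSphereLDA.tendsto_integral_of_tendsto_measure`);
* MOMENTUM, coordinate `j`: `(m_N[χ]ⱼ)² ≤ (sup|χ|)² · (N+1)⁻¹∑‖vᵢ(t)‖²`, and the mean squared speed is CONSERVED along the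
  flow (`sum_norm_sq_vel_flow_ae`) with static value `≤ 3 sup θ₀ + sup‖u₀‖²` (`lintegral_avg_norm_sq_vel_le`): a uniform
  second-moment bound, so `tendsto_integral_of_tendsto_measure_of_sq_le` applies (this is the momentum block of
  `NearConstantShortTimeHL.meansConverge_of_nearConstantShortTimeHL` transplanted to the conjunct family);
* ENERGY (the `L²` route): `(e_N[χ])² ≤ (sup|χ|)² · ((N+1)⁻¹∑‖vᵢ(t)‖²/2)² = (sup|χ|)² · k_N(0)²` a.s. (conservation) and
  `E[k_N(0)²] ≤ 2(sup‖u₀‖⁴ + 15 sup θ₀²)` (`lintegral_kineticEnergy_sq_le`, Gaussian fourth moments), then again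
  `tendsto_integral_of_tendsto_measure_of_sq_le`.
No definitions. References: C. Kipnis – C. Landim (1999), App. 1 §8; H. Spohn (1991), Part I §2.3, Ch. 3;
H.-T. Yau, Lett. Math. Phys. 22 (1991) §2.
-/

noncomputable section

namespace Summit.AtomisticToContinuum.HydrodynamicLimit.Theorems.RestartPrinciple

open scoped BigOperators ENNReal Topology
open MeasureTheory Set Filter
open Literature.MathematicalPhysics.KineticTheory Literature.Analysis.FluidPDE Literature.Analysis.FunctionSpaces
open Summit.AtomisticToContinuum.HydrodynamicLimit.Theses
open Summit.AtomisticToContinuum.HydrodynamicLimit.Theorems.NearConstantShortTimeHL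
open Summit.AtomisticToContinuum.HydrodynamicLimit.Theorems.AmplitudeTransfer (integral_apply_V3)

/-- **Convergence in probability of the hydrodynamic fields at time `t` under the local Gibbs laws upgrades to
convergence of the expectations** (continuous profiles `a₀ > 0`, `θ₀ > 0`, `u₀`; `σ ≤ 1/2`; a classical hs-Euler solution on
`[0, T)` and `t ∈ [0, T)`, so that the slices `ρ t`, `u t` are continuous; continuous test function `χ`; solution-frame
variant of p128777's `AgeDuhamelForgetting.tendsto_means_flow_of_tendstoHydroFieldsAt`): density by bounded convergence, momentum coordinatewise and energy by the
uniform second-moment bounds furnished by energy conservation along the flow and the Gaussian velocity statistics of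
the local Gibbs law at time `0`. [cite: KipnisLandim1999, App. 1 §8] -/
theorem tendsto_means_flow_of_tendstoHydroFieldsAt_of_solution {σ : ℝ} {a₀ θ₀ : T3 → ℝ} {u₀ : T3 → V3}
    (ha : Continuous a₀) (hθ : Continuous θ₀) (hu : Continuous u₀) (ha0 : ∀ x, 0 < a₀ x) (hθ0 : ∀ x, 0 < θ₀ x)
    (hσ2 : σ ≤ 1 / 2) (Φ : (N : ℕ) → HardSphereFlow (Torus.geometry (Fin 3)) (hsDiameter σ N) (N + 1))
    {T : ℝ} {ρ θ : ℝ → T3 → ℝ} {u : ℝ → T3 → V3} (hE : IsHardSphereEulerSolution σ T ρ u θ) {t : ℝ}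
    (ht : t ∈ Ico 0 T) (HL : TendstoHydroFieldsAt (fun N => localGibbsLaw σ a₀ u₀ θ₀ N (Φ N)) Φ ρ u θ t)
    {χ : T3 → ℝ} (hχ : Continuous χ) :
    Tendsto (fun N : ℕ => ∫ z, empiricalDensityField ((Φ N).flow t z) χ ∂(localGibbsLaw σ a₀ u₀ θ₀ N (Φ N))) atTop
        (𝓝 (∫ x, χ x * ρ t x)) ∧
      (∀ j : Fin 3, Tendsto (fun N : ℕ => ∫ z, empiricalMomentumField ((Φ N).flow t z) χ j
          ∂(localGibbsLaw σ a₀ u₀ θ₀ N (Φ N))) atTop (𝓝 (∫ x, χ x * ρ t x * u t x j))) ∧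
      Tendsto (fun N : ℕ => ∫ z, empiricalEnergyField ((Φ N).flow t z) χ ∂(localGibbsLaw σ a₀ u₀ θ₀ N (Φ N))) atTop
        (𝓝 (∫ x, χ x * totalEnergyDensity (ρ t x) (u t x) (θ t x))) := by
  -- adapted from `NearConstantShortTimeHL.meansConverge_of_nearConstantShortTimeHL` (density and momentum blocks)
  have hρc : Continuous (ρ t) := (hE.smooth_density.isSmooth_slice ht).continuous
  have huc : Continuous (u t) := (hE.smooth_velocity.isSmooth_slice ht).continuous
  set P : (N : ℕ) → Measure (Config (N + 1) (Fin 3) T3) := fun N => localGibbsLaw σ a₀ u₀ θ₀ N (Φ N) with hPdef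
  haveI hPI : ∀ N, IsProbabilityMeasure (P N) := fun N =>
    isProbabilityMeasure_localGibbsLaw ha hθ hu ha0 hθ0 hσ2 N (Φ N)
  haveI hPI' : ∀ N, IsProbabilityMeasure (particleLaw (Φ N)
      (canonicalDensity (Torus.geometry (Fin 3)) (hsDiameter σ N) (N + 1) (localGibbsProfile a₀ u₀ θ₀))) := hPI
  have hPac : ∀ N, P N ≪ liouville (Torus.geometry (Fin 3)) (N + 1) (hsDiameter σ N) := fun N =>
    particleLaw_absolutelyContinuous (Φ N) _
  have ha0' : ∀ x, 0 ≤ a₀ x := fun x => (ha0 x).le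
  -- bounds on the profiles and on the test function
  obtain ⟨Θ, hΘ0, hΘ⟩ := exists_forall_abs_le_of_continuous hθ
  obtain ⟨U, hU0, hU⟩ := exists_forall_abs_le_of_continuous (continuous_norm.comp hu)
  have hΘ' : ∀ x, θ₀ x ≤ Θ := fun x => (le_abs_self _).trans (hΘ x)
  have hU' : ∀ x, ‖u₀ x‖ ≤ U := fun x => (le_abs_self _).trans (hU x)
  obtain ⟨Cχ, hCχ0, hCχ⟩ := exists_forall_abs_le_of_continuous hχ
  set B₁ : ℝ := 3 * Θ + U ^ 2 with hB₁def
  have hB₁ : ∀ x, 3 * θ₀ x + ‖u₀ x‖ ^ 2 ≤ B₁ := fun x => by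
    have h1 : θ₀ x ≤ Θ := hΘ' x
    have h2 : ‖u₀ x‖ ^ 2 ≤ U ^ 2 := pow_le_pow_left₀ (norm_nonneg _) (hU' x) 2
    rw [hB₁def]
    linarith
  set B₂ : ℝ := 2 * (U ^ 4 + 15 * Θ ^ 2) with hB₂def
  /- ### Uniform second velocity moment, at every time (conservation + statics at `t = 0`) -/
  have hV0 : ∀ N, ∫⁻ z, ENNReal.ofReal ((((N + 1 : ℕ)) : ℝ)⁻¹ * ∑ i, ‖(z i).2‖ ^ 2) ∂P N ≤ ENNReal.ofReal B₁ :=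
    fun N => lintegral_avg_norm_sq_vel_le (Φ N) ha hθ hu ha0' hθ0 hB₁
  have hVs : ∀ (N : ℕ) (s : ℝ),
      ∫⁻ z, ENNReal.ofReal ((((N + 1 : ℕ)) : ℝ)⁻¹ * ∑ i, ‖((Φ N).flow s z i).2‖ ^ 2) ∂P N ≤ ENNReal.ofReal B₁ := by
    intro N s
    refine le_trans (le_of_eq (lintegral_congr_ae ?_)) (hV0 N)
    filter_upwards [sum_norm_sq_vel_flow_ae (Φ N) (hPac N) s] with z hz
    show ENNReal.ofReal ((((N + 1 : ℕ)) : ℝ)⁻¹ * ∑ i, ‖((Φ N).flow s z i).2‖ ^ 2) =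
      ENNReal.ofReal ((((N + 1 : ℕ)) : ℝ)⁻¹ * ∑ i, ‖(z i).2‖ ^ 2)
    rw [show (∑ i, ‖((Φ N).flow s z i).2‖ ^ 2) = ∑ i, ‖(z i).2‖ ^ 2 from hz]
  /- ### Uniform second moment of the kinetic energy per particle, at every time -/
  have hK0 : ∀ N, ∫⁻ z, ENNReal.ofReal (((((N + 1 : ℕ)) : ℝ)⁻¹ * ∑ i, ‖(z i).2‖ ^ 2 / 2) ^ 2) ∂P N ≤
      ENNReal.ofReal B₂ :=
    fun N => lintegral_kineticEnergy_sq_le (Φ N) ha hθ hu ha0' hθ0 hΘ' hU'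
  have hKs : ∀ (N : ℕ) (s : ℝ),
      ∫⁻ z, ENNReal.ofReal (((((N + 1 : ℕ)) : ℝ)⁻¹ * ∑ i, ‖((Φ N).flow s z i).2‖ ^ 2 / 2) ^ 2) ∂P N ≤
        ENNReal.ofReal B₂ := by
    intro N s
    refine le_trans (le_of_eq (lintegral_congr_ae ?_)) (hK0 N)
    filter_upwards [sum_norm_sq_vel_flow_ae (Φ N) (hPac N) s] with z hz
    show ENNReal.ofReal (((((N + 1 : ℕ)) : ℝ)⁻¹ * ∑ i, ‖((Φ N).flow s z i).2‖ ^ 2 / 2) ^ 2) =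
      ENNReal.ofReal (((((N + 1 : ℕ)) : ℝ)⁻¹ * ∑ i, ‖(z i).2‖ ^ 2 / 2) ^ 2)
    rw [← Finset.sum_div, ← Finset.sum_div, show (∑ i, ‖((Φ N).flow s z i).2‖ ^ 2) = ∑ i, ‖(z i).2‖ ^ 2 from hz]
  /- ### DENSITY -/
  have hDm : ∀ N, Measurable fun z => empiricalDensityField ((Φ N).flow t z) χ := fun N =>
    (continuous_empiricalDensityField hχ).measurable.comp ((Φ N).measurable_flow t)
  have hDb : ∀ N z, |empiricalDensityField ((Φ N).flow t z) χ| ≤ Cχ := fun N z =>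
    abs_empiricalDensityField_le hCχ hCχ0 _
  have hDT : Tendsto (fun N => ∫ z, empiricalDensityField ((Φ N).flow t z) χ ∂P N) atTop
      (𝓝 (∫ x, χ x * ρ t x)) :=
    HardSphereLDA.tendsto_integral_of_tendsto_measure P hDm hDb fun δ hδ => (HL χ hχ δ hδ).1
  /- ### MOMENTUM -/
  have hMm : ∀ N, Measurable fun z => empiricalMomentumField ((Φ N).flow t z) χ := fun N =>
    (continuous_empiricalMomentumField hχ).measurable.comp ((Φ N).measurable_flow t)
  have hMlm : ∀ (N : ℕ) (l : Fin 3), Measurable fun z => empiricalMomentumField ((Φ N).flow t z) χ l :=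
    fun N l => (EuclideanSpace.proj (𝕜 := ℝ) l).measurable.comp (hMm N)
  have hMl2 : ∀ (N : ℕ) (l : Fin 3),
      ∫⁻ z, ENNReal.ofReal ((empiricalMomentumField ((Φ N).flow t z) χ l) ^ 2) ∂P N ≤
        ENNReal.ofReal (Cχ ^ 2 * B₁) := by
    intro N l
    have hpt : ∀ z, ENNReal.ofReal ((empiricalMomentumField ((Φ N).flow t z) χ l) ^ 2) ≤
        ENNReal.ofReal (Cχ ^ 2) *
          ENNReal.ofReal ((((N + 1 : ℕ)) : ℝ)⁻¹ * ∑ i, ‖((Φ N).flow t z i).2‖ ^ 2) := by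
      intro z
      rw [← ENNReal.ofReal_mul (sq_nonneg _)]
      refine ENNReal.ofReal_le_ofReal ?_
      have h1 : |empiricalMomentumField ((Φ N).flow t z) χ l| ≤ ‖empiricalMomentumField ((Φ N).flow t z) χ‖ := by
        simpa using abs_apply_sub_le_norm (empiricalMomentumField ((Φ N).flow t z) χ) 0 l
      calc (empiricalMomentumField ((Φ N).flow t z) χ l) ^ 2
          = |empiricalMomentumField ((Φ N).flow t z) χ l| ^ 2 := (sq_abs _).symm
        _ ≤ ‖empiricalMomentumField ((Φ N).flow t z) χ‖ ^ 2 := pow_le_pow_left₀ (abs_nonneg _) h1 2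
        _ ≤ Cχ ^ 2 * ((((N + 1 : ℕ)) : ℝ)⁻¹ * ∑ i, ‖((Φ N).flow t z i).2‖ ^ 2) :=
            norm_empiricalMomentumField_sq_le hCχ hCχ0 _
    calc ∫⁻ z, ENNReal.ofReal ((empiricalMomentumField ((Φ N).flow t z) χ l) ^ 2) ∂P N
        ≤ ∫⁻ z, ENNReal.ofReal (Cχ ^ 2) *
            ENNReal.ofReal ((((N + 1 : ℕ)) : ℝ)⁻¹ * ∑ i, ‖((Φ N).flow t z i).2‖ ^ 2) ∂P N := lintegral_mono hpt
      _ = ENNReal.ofReal (Cχ ^ 2) *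
            ∫⁻ z, ENNReal.ofReal ((((N + 1 : ℕ)) : ℝ)⁻¹ * ∑ i, ‖((Φ N).flow t z i).2‖ ^ 2) ∂P N :=
          lintegral_const_mul' _ _ ENNReal.ofReal_ne_top
      _ ≤ ENNReal.ofReal (Cχ ^ 2) * ENNReal.ofReal B₁ := mul_le_mul_right (hVs N t) _
      _ = ENNReal.ofReal (Cχ ^ 2 * B₁) := (ENNReal.ofReal_mul (sq_nonneg _)).symm
  have hIl : ∀ l : Fin 3, (∫ x, (χ x * ρ t x) • u t x) l = ∫ x, χ x * ρ t x * u t x l := fun l => by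
    have hi : Integrable (fun x => (χ x * ρ t x) • u t x) (volume : Measure T3) :=
      integrable_of_continuous_T3 ((hχ.mul hρc).smul huc)
    rw [integral_apply_V3 hi l]
    rfl
  have hMlP : ∀ (l : Fin 3) (δ : ℝ), 0 < δ → Tendsto (fun N => P N {z | δ <
      |empiricalMomentumField ((Φ N).flow t z) χ l - ∫ x, χ x * ρ t x * u t x l|}) atTop (𝓝 0) := by
    intro l δ hδ
    refine tendsto_of_tendsto_of_tendsto_of_le_of_le tendsto_const_nhds (HL χ hχ δ hδ).2.1
      (fun N => bot_le) fun N => ?_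
    refine measure_mono fun z hz => ?_
    simp only [mem_setOf_eq] at hz ⊢
    rw [← hIl l] at hz
    exact hz.trans_le (abs_apply_sub_le_norm _ _ l)
  have hMlT : ∀ l : Fin 3, Tendsto (fun N => ∫ z, empiricalMomentumField ((Φ N).flow t z) χ l ∂P N) atTop
      (𝓝 (∫ x, χ x * ρ t x * u t x l)) := fun l =>
    tendsto_integral_of_tendsto_measure_of_sq_le P (fun N => hMlm N l) (fun N => hMl2 N l) (hMlP l)
  /- ### ENERGY (the `L²` route) -/
  have hEm : ∀ N, Measurable fun z => empiricalEnergyField ((Φ N).flow t z) χ := fun N =>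
    (continuous_empiricalEnergyField hχ).measurable.comp ((Φ N).measurable_flow t)
  have hE2 : ∀ N, ∫⁻ z, ENNReal.ofReal ((empiricalEnergyField ((Φ N).flow t z) χ) ^ 2) ∂P N ≤
      ENNReal.ofReal (Cχ ^ 2 * B₂) := by
    intro N
    have hpt : ∀ z, ENNReal.ofReal ((empiricalEnergyField ((Φ N).flow t z) χ) ^ 2) ≤
        ENNReal.ofReal (Cχ ^ 2) *
          ENNReal.ofReal (((((N + 1 : ℕ)) : ℝ)⁻¹ * ∑ i, ‖((Φ N).flow t z i).2‖ ^ 2 / 2) ^ 2) := by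
      intro z
      rw [← ENNReal.ofReal_mul (sq_nonneg _)]
      refine ENNReal.ofReal_le_ofReal ?_
      have h1 := abs_empiricalEnergyField_le hCχ ((Φ N).flow t z)
      calc (empiricalEnergyField ((Φ N).flow t z) χ) ^ 2
          = |empiricalEnergyField ((Φ N).flow t z) χ| ^ 2 := (sq_abs _).symm
        _ ≤ (Cχ * ((((N + 1 : ℕ)) : ℝ)⁻¹ * ∑ i, ‖((Φ N).flow t z i).2‖ ^ 2 / 2)) ^ 2 :=
            pow_le_pow_left₀ (abs_nonneg _) h1 2
        _ = Cχ ^ 2 * ((((N + 1 : ℕ)) : ℝ)⁻¹ * ∑ i, ‖((Φ N).flow t z i).2‖ ^ 2 / 2) ^ 2 := mul_pow _ _ 2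
    calc ∫⁻ z, ENNReal.ofReal ((empiricalEnergyField ((Φ N).flow t z) χ) ^ 2) ∂P N
        ≤ ∫⁻ z, ENNReal.ofReal (Cχ ^ 2) *
            ENNReal.ofReal (((((N + 1 : ℕ)) : ℝ)⁻¹ * ∑ i, ‖((Φ N).flow t z i).2‖ ^ 2 / 2) ^ 2) ∂P N :=
          lintegral_mono hpt
      _ = ENNReal.ofReal (Cχ ^ 2) *
            ∫⁻ z, ENNReal.ofReal (((((N + 1 : ℕ)) : ℝ)⁻¹ * ∑ i, ‖((Φ N).flow t z i).2‖ ^ 2 / 2) ^ 2) ∂P N :=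
          lintegral_const_mul' _ _ ENNReal.ofReal_ne_top
      _ ≤ ENNReal.ofReal (Cχ ^ 2) * ENNReal.ofReal B₂ := mul_le_mul_right (hKs N t) _
      _ = ENNReal.ofReal (Cχ ^ 2 * B₂) := (ENNReal.ofReal_mul (sq_nonneg _)).symm
  have hET : Tendsto (fun N => ∫ z, empiricalEnergyField ((Φ N).flow t z) χ ∂P N) atTop
      (𝓝 (∫ x, χ x * totalEnergyDensity (ρ t x) (u t x) (θ t x))) :=
    tendsto_integral_of_tendsto_measure_of_sq_le P hEm hE2 fun δ hδ => (HL χ hχ δ hδ).2.2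
  /- ### Assembly -/
  exact ⟨hDT, hMlT, hET⟩

/-- **THE (PACKING-GUARDED) CONJUNCT IMPLIES THE MEAN HYDRODYNAMIC LIMIT IN THE BAND** (registered sub-goal
`meanHydroLimitInBand_of_hydrodynamicLimit` of crux stmt-AtomisticToContinuum-12503, line `IdeatorFourSketch`; leverage
certificate `G ⟹ stmt-11927`): `_root_.HydrodynamicLimit → ResponseRigidity.MeanHydroLimitInBand`, with witnesses `η := η₀`
and, per profile, `σ₀ := min σ₀ (1/2)`; inside the frame the conjunct's convergence in probability at time `t` is upgraded
to convergence of the expectations by `tendsto_means_flow_of_tendstoHydroFieldsAt_of_solution` (uniform integrability from energy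
conservation and the Gaussian statics). Re-landing of `meanHydroLimitInBand_of_hydroLimitInBand` (p128777) against the
re-typed sub-problem decl. [cite: KipnisLandim1999, App. 1 §8] -/
theorem meanHydroLimitInBand_of_hydrodynamicLimit : _root_.HydrodynamicLimit → ResponseRigidity.MeanHydroLimitInBand := by
  rintro ⟨η₀, hη₀, H⟩
  refine ⟨η₀, hη₀, fun a₀ θ₀ u₀ ha hθ hu ha0 hθ0 => ?_⟩
  obtain ⟨σ₀, hσ₀, H1⟩ := H a₀ θ₀ u₀ ha hθ hu ha0 hθ0
  refine ⟨min σ₀ (1 / 2), lt_min hσ₀ one_half_pos, ?_⟩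
  intro σ hσ hσ' T ρ θ u hE hband Φ h0 t ht χ hχ
  have hσ1 : σ < σ₀ := hσ'.trans_le (min_le_left _ _)
  have hσ2 : σ ≤ 1 / 2 := (hσ'.trans_le (min_le_right _ _)).le
  have HL : TendstoHydroFieldsAt (fun N => localGibbsLaw σ a₀ u₀ θ₀ N (Φ N)) Φ ρ u θ t :=
    H1 σ hσ hσ1 T ρ θ u hE hband Φ h0 t ht
  exact tendsto_means_flow_of_tendstoHydroFieldsAt_of_solution ha hθ hu ha0 hθ0 hσ2 Φ hE ht HL hχ.continuous

end Summit.AtomisticToContinuum.HydrodynamicLimit.Theorems.RestartPrinciple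

end
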